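import Mathlib
import Summits.CriticalPhenomena.SAWScalingLimit.Theorems.SAWDefectDecoherenceDefectDecoherenceTmAdmissible
import Summits.CriticalPhenomena.SAWScalingLimit.Theorems.SAWDefectDecoherenceDefectDecoherenceTmStrataPrelim
import HarnessLib

/-!
# The strata bound for the walks leaving a large ball
(helper `tm_strata_bound` for the stub `stub_telescopingRecursion` of the line
`tip-martingale-depth-induction`, crux `DefectDecoherence`, stmt-CriticalPhenomena-8549)

For an admissible configuration `(D, y, z, v)` at depth `r` whose root enters `B(v,r)` and
`L = C r`, `C ≥ 1`: `‖TC[D, exits B(v,L)]‖ ≤ strataSum c β B₀ r N η C · M(D,y,z,v)` given a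
nonnegative profile `η` with `DepthBound ρ (η ρ)` for `ρ ≥ 1`, `CrudeBound B₀`, `ExitBound c β` and
`r/2^N ≥ 1` (`strata_bound`, registered as `tm_strata_bound`).  Stratify the exiting walks by the
closest pre-exit approach `d`: stratum `j < N` (`d ∈ (r/2^{j+1}, r/2^j]`) is renewed at its first
entrance into `B(v, r/2^{j+1})` (the stratum is a function of the prefix, `inner_stratum_eq`), pays
`η(r/2^{j+1})` on the slit domain and a wall-exit mass `≤ c (C2^j)^{-β} M` (`TR_Ex_EE_le`: stop at
the first entrance into `B(v, r/2^j)` and apply `ExitBound` to the slit domain); the last stratum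
pays the crude constant.  Also: generic `prefixSum` algebra used by the assembly.

Sources: H. Duminil-Copin, S. Smirnov, *The connective constant of the honeycomb lattice equals
`√(2+√2)`*, Ann. of Math. 175 (2012) (arXiv:1007.0575), §1–§2 (walks between mid-edges, windings,
Definition 1); the line card `Lines/tip-martingale-depth-induction.md` of the crux.
Deliberately NOT here: telescoping over picture scales, orbit regrouping (file `…TmOrbit`).
-/

noncomputable section

open scoped BigOperators ComplexConjugate Classical
open Literature.Probability.LatticeModels Literature.Probability.RandomPlanarGeometry.SAW

namespace Summit.CriticalPhenomena.SAWScalingLimit.Theorems.DefectDecoherence.TipMartingale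

/-! ### The strata bound -/

section Strata

variable {D : Finset HexVertex} {y z v : HexVertex}

/-- Admissibility is monotone in the depth (down to `1`). [folklore] -/
theorem admissible_mono {r ρ : ℝ} (hA : Admissible D y z v r) (hρ : 1 ≤ ρ) (hρr : ρ ≤ r) :
    Admissible D y z v ρ := by
  obtain ⟨h1, h2, h3, h4, -, h6⟩ := hA
  exact (admissible_iff _ _ _ _ _).2 ⟨h1, h2, h3, h4, hρ, fun q hq => h6 q (hq.trans hρr)⟩

/-- Walks from an admissible root to the star of `v` start at the inner root vertex `z`.
[folklore] -/
theorem head_eq_root {r : ℝ} (hA : Admissible D y z v r) {t : HexVertex} (ht : t ∈ star D v)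
    (ω : HexMidEdgeSAW D s(y, z) s(v, t)) : ω.verts.head? = some z := by
  obtain ⟨-, -, hy, -, h1, hdeep⟩ := hA
  have hv : v ∈ D := hdeep v (by rw [dist_self]; linarith)
  have hne : ω.verts ≠ [] := fun h => by
    have e := ω.eq_of_nil h
    have : y ∈ s(v, t) := by rw [← e]; exact Sym2.mem_mk_left _ _
    rcases Sym2.mem_iff.1 this with rfl | rfl
    · exact hy hv
    · exact hy (Finset.mem_filter.1 ht).1
  rw [List.head?_eq_some_head hne, ω.head_eq rfl hy hne]

/-- **Norms of prefix sums**: `‖Σ_π [prefix] w(π) f(π)‖ ≤ Σ_π [prefix] x_c^{|π|} g(π)` whenever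
`‖f(π)‖ ≤ g(π)` on prefixes. [folklore] -/
theorem norm_prefixSum_le {u w : HexVertex} {ρ : ℝ}
    (f : ∀ p : HexVertex × HexVertex, HexMidEdgeSAW D s(u, w) s(p.1, p.2) → ℂ)
    (g : ∀ p : HexVertex × HexVertex, HexMidEdgeSAW D s(u, w) s(p.1, p.2) → ℝ)
    (h : ∀ p π, IsPrefix v ρ p.1 p.2 π → ‖f p π‖ ≤ g p π) :
    ‖∑ p ∈ D ×ˢ D, ∑ π : HexMidEdgeSAW D s(u, w) s(p.1, p.2),
        (if IsPrefix v ρ p.1 p.2 π then π.weight xc (5 / 8) * f p π else 0)‖ ≤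
      ∑ p ∈ D ×ˢ D, ∑ π : HexMidEdgeSAW D s(u, w) s(p.1, p.2),
        (if IsPrefix v ρ p.1 p.2 π then xc ^ π.length * g p π else 0) := by
  refine (norm_sum_le _ _).trans (Finset.sum_le_sum fun p _ => (norm_sum_le _ _).trans
    (Finset.sum_le_sum fun π _ => ?_))
  split_ifs with hP
  · rw [norm_mul, π.norm_weight xc_pos.le]
    exact mul_le_mul_of_nonneg_left (h p π hP) (pow_nonneg xc_pos.le _)
  · simp

/-- **The wall-exit mass of a stratum**: the mass of the walks that exit `B(v,L)` having come
within `ρ` before their first exit is at most `c (L/ρ)^{-β} M` (stop at the first entrance into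
`B(v,ρ)` and apply `ExitBound` to the slit domain at depth `ρ`). [folklore] -/
theorem TR_Ex_EE_le {c β : ℝ} (hE : ExitBound c β) {r ρ L : ℝ}
    (hA : Admissible D y z v r) (hρ : 1 ≤ ρ) (hρr : ρ ≤ r) (hrL : r ≤ L) :
    TR D s(y, z) v (fun l => l ∈ Ex v L ∧ l ∈ EE v L ρ) ≤ c * (L / ρ) ^ (-β) * mass D y z v := by
  have hA' := admissible_mono hA hρ hρr
  have hy : y ∉ D := hA.2.2.1
  by_cases hzρ : dist (hexCenter z) (hexCenter v) ≤ ρ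
  · calc TR D s(y, z) v (fun l => l ∈ Ex v L ∧ l ∈ EE v L ρ)
        ≤ TR D s(y, z) v (· ∈ Ex v L) := TR_mono (fun l h => h.1) _ _ _
      _ = exitMass D y z v L := (exitMass_eq_TR D y z v L).symm
      _ ≤ c * (L / ρ) ^ (-β) * mass D y z v := hE D y z v ρ L hA' hzρ (hρr.trans hrL)
  · rw [not_le] at hzρ
    rw [TR_renewal hy hzρ hρ, tm_mass_renewal D y z v ρ hy hρ hzρ, prefixSumR, Finset.mul_sum]
    refine Finset.sum_le_sum fun p _ => ?_
    rw [Finset.mul_sum]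
    refine Finset.sum_le_sum fun π _ => ?_
    split_ifs with hP
    · rw [mul_left_comm]
      refine mul_le_mul_of_nonneg_left ?_ (pow_nonneg xc_pos.le _)
      have hout := ((isPrefix_iff π).1 hP).2.2.2
      calc _ ≤ TR (D \ π.verts.toFinset) s(p.1, p.2) v (· ∈ Ex v L) :=
            TR_mono (fun l h => Ex_of_append hout h) _ _ _
        _ = exitMass (D \ π.verts.toFinset) p.1 p.2 v L := (exitMass_eq_TR _ _ _ _ _).symm
        _ ≤ c * (L / ρ) ^ (-β) * mass (D \ π.verts.toFinset) p.1 p.2 v :=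
            hE _ _ _ _ ρ L (admissible_sdiff hA hρ hρr hP) ((isPrefix_iff π).1 hP).2.2.1
              (hρr.trans hrL)
    · simp

/-- For a first-entrance prefix `π` into `B(v,ρ')` (`ρ' ≤ L`), the stratum-restricted defect
of the continuations is `[stratum(π)] · T(D ∖ π)`. [folklore] -/
theorem inner_stratum_eq {r ρ ρ' L : ℝ} (hA : Admissible D y z v r) (hρ'1 : 1 ≤ ρ')
    (hρ'r : ρ' ≤ r) (hρ'L : ρ' ≤ L) {p : HexVertex × HexVertex}
    {π : HexMidEdgeSAW D s(y, z) s(p.1, p.2)} (hP : IsPrefix v ρ' p.1 p.2 π) :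
    TC (D \ π.verts.toFinset) s(p.1, p.2) v (fun l => π.verts ++ l ∈ Ex v L ∧
        π.verts ++ l ∈ EE v L ρ ∧ π.verts ++ l ∉ EE v L ρ') =
      if π.verts ∈ Ex v L ∧ π.verts ∈ EE v L ρ ∧ π.verts ∉ EE v L ρ' then
        defect (D \ π.verts.toFinset) p.1 p.2 v else 0 := by
  have hA' := admissible_sdiff hA hρ'1 hρ'r hP
  have hzρ := ((isPrefix_iff π).1 hP).2.2.1
  have key : ∀ t ∈ star (D \ π.verts.toFinset) v,
      ∀ ω' : HexMidEdgeSAW (D \ π.verts.toFinset) s(p.1, p.2) s(v, t),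
      (π.verts ++ ω'.verts ∈ Ex v L ∧ π.verts ++ ω'.verts ∈ EE v L ρ ∧
          π.verts ++ ω'.verts ∉ EE v L ρ') ↔
        (π.verts ∈ Ex v L ∧ π.verts ∈ EE v L ρ ∧ π.verts ∉ EE v L ρ') := fun t ht ω' =>
    stratum_append_iff hρ'L (head_eq_root hA' ht ω') hzρ
  split_ifs with hS
  · rw [defect_eq_TC, TC, TC]
    refine Finset.sum_congr rfl fun t ht => ?_
    congr 1
    refine Finset.sum_congr rfl fun ω' _ => ?_
    rw [if_pos ((key t ht ω').2 hS), if_pos trivial]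
  · rw [TC]
    refine Finset.sum_eq_zero fun t ht => mul_eq_zero_of_right _ (Finset.sum_eq_zero fun ω' _ => ?_)
    rw [if_neg]
    exact fun h => hS ((key t ht ω').1 h)

/-- … and the mass of the continuations dominates `[Ex ∧ EE](π) · M(D ∖ π)`. [folklore] -/
theorem inner_mass_le {ρ L : ℝ} {p : HexVertex × HexVertex}
    (π : HexMidEdgeSAW D s(y, z) s(p.1, p.2)) :
    (if π.verts ∈ Ex v L ∧ π.verts ∈ EE v L ρ then mass (D \ π.verts.toFinset) p.1 p.2 v
      else 0) ≤
      TR (D \ π.verts.toFinset) s(p.1, p.2) v (fun l => π.verts ++ l ∈ Ex v L ∧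
        π.verts ++ l ∈ EE v L ρ) := by
  rw [TR]
  split_ifs with hS
  · rw [mass_eq_TR, TR]
    refine Finset.sum_le_sum fun t _ => Finset.sum_le_sum fun ω' _ => ?_
    rw [if_pos trivial, if_pos (Ex_EE_append hS _)]
  · exact Finset.sum_nonneg fun t _ => Finset.sum_nonneg fun ω' _ => by
      split_ifs
      · exact pow_nonneg xc_pos.le _
      · exact le_rfl

/-- **Stratification of the exit defect** by the closest pre-exit approach: with radii
`ρ₀ ≥ ρ₁ ≥ ⋯` and every walk within `ρ₀` before its first exit,
`TC[Ex] = Σ_{j<N} TC[Ex ∧ EE ρⱼ ∧ ¬EE ρⱼ₊₁] + TC[Ex ∧ EE ρ_N]`. [folklore] -/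
theorem TC_strata_split {a : Sym2 HexVertex} {L : ℝ} (ρ : ℕ → ℝ) (hmono : ∀ j, ρ (j + 1) ≤ ρ j)
    (h0 : ∀ t ∈ star D v, ∀ ω : HexMidEdgeSAW D a s(v, t), ω.verts ∈ EE v L (ρ 0)) (N : ℕ) :
    TC D a v (· ∈ Ex v L) =
      (∑ j ∈ Finset.range N,
        TC D a v fun l => l ∈ Ex v L ∧ l ∈ EE v L (ρ j) ∧ l ∉ EE v L (ρ (j + 1))) +
      TC D a v fun l => l ∈ Ex v L ∧ l ∈ EE v L (ρ N) := by
  simp only [TC]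
  rw [Finset.sum_comm, ← Finset.sum_add_distrib]
  refine Finset.sum_congr rfl fun t ht => ?_
  rw [← Finset.mul_sum, ← mul_add]
  congr 1
  rw [Finset.sum_comm, ← Finset.sum_add_distrib]
  refine Finset.sum_congr rfl fun ω _ => ?_
  rw [ite_telescope (fun j => ω.verts ∈ EE v L (ρ j)) (fun j h => EE_mono (hmono j) h) (h0 t ht ω)
    (if ω.verts ∈ Ex v L then ω.weight xc (5 / 8) else 0) N]
  congr 1
  · refine Finset.sum_congr rfl fun j _ => ?_
    by_cases h1 : ω.verts ∈ Ex v L <;>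
      by_cases h2 : ω.verts ∈ EE v L (ρ j) ∧ ω.verts ∉ EE v L (ρ (j + 1)) <;> simp [h1, h2]
  · by_cases h1 : ω.verts ∈ Ex v L <;> by_cases h2 : ω.verts ∈ EE v L (ρ N) <;> simp [h1, h2]

/-- **THE STRATA BOUND** (step (6) of the line): for an admissible configuration at depth `r`
whose root enters `B(v,r)`, and `L = C r` (`C ≥ 1`), the defect carried by the walks leaving
`B(v,L)` is at most `strataSum c β B₀ r N η C · M`: stratum `j < N` (closest pre-exit approach
in `(r/2^{j+1}, r/2^j]`) is renewed at its first entrance into `B(v, r/2^{j+1})` and pays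
`η(r/2^{j+1})` (depth bound on the slit domain) times a wall-exit mass `c (C2^j)^{-β} M`; the
last stratum pays the crude constant. [folklore] -/
theorem strata_bound {c β B₀ r C : ℝ} {N : ℕ} {η : ℝ → ℝ} (hc : 0 ≤ c) (hη : ∀ ρ, 0 ≤ η ρ)
    (hD : ∀ ρ, 1 ≤ ρ → DepthBound ρ (η ρ)) (hB : CrudeBound B₀) (hE : ExitBound c β)
    (hN : 1 ≤ r / 2 ^ N) (hC : 1 ≤ C) (hA : Admissible D y z v r)
    (hz : dist (hexCenter z) (hexCenter v) ≤ r) {L : ℝ} (hL : C * r = L) :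
    ‖TC D s(y, z) v (· ∈ Ex v L)‖ ≤ strataSum c β B₀ r N η C * mass D y z v := by
  subst hL
  -- radii
  have h2N : (0 : ℝ) < 2 ^ N := pow_pos two_pos N
  have hr1 : 1 ≤ r := by
    have h1 := (le_div_iff₀ h2N).1 hN
    have h2 : (1 : ℝ) ≤ 2 ^ N := one_le_pow₀ one_le_two
    linarith
  have hr0 : 0 < r := by linarith
  have hrL : r ≤ C * r := le_mul_of_one_le_left hr0.le hC
  have hρ1 : ∀ j, j ≤ N → 1 ≤ r / 2 ^ j := fun j hj =>
    hN.trans (div_le_div_of_nonneg_left hr0.le (pow_pos two_pos j)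
      (pow_le_pow_right₀ one_le_two hj))
  have hρr : ∀ j : ℕ, r / 2 ^ j ≤ r := fun j => div_le_self hr0.le (one_le_pow₀ one_le_two)
  have hρmono : ∀ j : ℕ, r / 2 ^ (j + 1) ≤ r / 2 ^ j := fun j =>
    div_le_div_of_nonneg_left hr0.le (pow_pos two_pos j) (pow_le_pow_right₀ one_le_two j.le_succ)
  have hLρ : ∀ j : ℕ, C * r / (r / 2 ^ j) = C * 2 ^ j := fun j => by
    field_simp
  have hy : y ∉ D := hA.2.2.1
  have hM := mass_nonneg D y z v
  have hpow : ∀ j : ℕ, 0 ≤ (C * 2 ^ j) ^ (-β) := fun j =>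
    Real.rpow_nonneg (mul_nonneg (zero_le_one.trans hC) (pow_nonneg zero_le_two _)) _
  -- (1) stratification
  have h0 : ∀ t ∈ star D v, ∀ ω : HexMidEdgeSAW D s(y, z) s(v, t),
      ω.verts ∈ EE v (C * r) (r / 2 ^ 0) := fun t ht ω => by
    rw [List.eq_cons_of_mem_head? (head_eq_root hA ht ω), pow_zero, div_one]
    exact ⟨z, mem_preE_cons (hz.trans hrL) _, hz⟩
  rw [TC_strata_split (fun j => r / 2 ^ j) hρmono h0 N]
  -- (2) the strata `j < N`
  have hSj : ∀ j ∈ Finset.range N, ‖TC D s(y, z) v fun l => l ∈ Ex v (C * r) ∧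
      l ∈ EE v (C * r) (r / 2 ^ j) ∧ l ∉ EE v (C * r) (r / 2 ^ (j + 1))‖ ≤
        η (r / 2 ^ (j + 1)) * (c * (C * 2 ^ j) ^ (-β) * mass D y z v) := by
    intro j hj
    have hj' : j + 1 ≤ N := Finset.mem_range.1 hj
    have h1' : 1 ≤ r / 2 ^ (j + 1) := hρ1 _ hj'
    have hρ'L : r / 2 ^ (j + 1) ≤ C * r := (hρr _).trans hrL
    have hRHS : 0 ≤ η (r / 2 ^ (j + 1)) * (c * (C * 2 ^ j) ^ (-β) * mass D y z v) :=
      mul_nonneg (hη _) (mul_nonneg (mul_nonneg hc (hpow j)) hM)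
    by_cases hzρ : dist (hexCenter z) (hexCenter v) ≤ r / 2 ^ (j + 1)
    · -- empty stratum
      refine le_of_eq_of_le ?_ hRHS
      rw [norm_eq_zero, TC]
      refine Finset.sum_eq_zero fun t ht => ?_
      rw [Finset.sum_eq_zero fun ω _ => ?_, mul_zero]
      rw [if_neg]
      rintro ⟨-, -, h3⟩
      apply h3
      rw [List.eq_cons_of_mem_head? (head_eq_root hA ht ω)]
      exact ⟨z, mem_preE_cons (hzρ.trans hρ'L) _, hzρ⟩
    · rw [not_le] at hzρ
      rw [TC_renewal hy hzρ h1']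
      calc _ = ‖∑ p ∈ D ×ˢ D, ∑ π : HexMidEdgeSAW D s(y, z) s(p.1, p.2),
            (if IsPrefix v (r / 2 ^ (j + 1)) p.1 p.2 π then π.weight xc (5 / 8) *
              (if π.verts ∈ Ex v (C * r) ∧ π.verts ∈ EE v (C * r) (r / 2 ^ j) ∧
                  π.verts ∉ EE v (C * r) (r / 2 ^ (j + 1)) then
                defect (D \ π.verts.toFinset) p.1 p.2 v else 0) else 0)‖ := by
            congr 1
            refine Finset.sum_congr rfl fun p _ => Finset.sum_congr rfl fun π _ => ?_
            by_cases hP : IsPrefix v (r / 2 ^ (j + 1)) p.1 p.2 π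
            · rw [if_pos hP, if_pos hP, inner_stratum_eq hA h1' (hρr _) hρ'L hP]
            · rw [if_neg hP, if_neg hP]
        _ ≤ ∑ p ∈ D ×ˢ D, ∑ π : HexMidEdgeSAW D s(y, z) s(p.1, p.2),
            (if IsPrefix v (r / 2 ^ (j + 1)) p.1 p.2 π then xc ^ π.length *
              (η (r / 2 ^ (j + 1)) * if π.verts ∈ Ex v (C * r) ∧
                  π.verts ∈ EE v (C * r) (r / 2 ^ j) then
                mass (D \ π.verts.toFinset) p.1 p.2 v else 0) else 0) :=
            norm_prefixSum_le _ _ fun p π hP => by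
              split_ifs with hS hS'
              · exact hD _ h1' _ _ _ _ (admissible_sdiff hA h1' (hρr _) hP)
              · exact absurd ⟨hS.1, hS.2.1⟩ hS'
              · rw [norm_zero]; exact mul_nonneg (hη _) (mass_nonneg _ _ _ _)
              · simp
        _ = η (r / 2 ^ (j + 1)) * ∑ p ∈ D ×ˢ D, ∑ π : HexMidEdgeSAW D s(y, z) s(p.1, p.2),
            (if IsPrefix v (r / 2 ^ (j + 1)) p.1 p.2 π then xc ^ π.length *
              (if π.verts ∈ Ex v (C * r) ∧ π.verts ∈ EE v (C * r) (r / 2 ^ j) then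
                mass (D \ π.verts.toFinset) p.1 p.2 v else 0) else 0) := by
            rw [Finset.mul_sum]
            refine Finset.sum_congr rfl fun p _ => ?_
            rw [Finset.mul_sum]
            refine Finset.sum_congr rfl fun π _ => ?_
            split_ifs <;> ring
        _ ≤ η (r / 2 ^ (j + 1)) *
            TR D s(y, z) v (fun l => l ∈ Ex v (C * r) ∧ l ∈ EE v (C * r) (r / 2 ^ j)) := by
            refine mul_le_mul_of_nonneg_left ?_ (hη _)
            rw [TR_renewal hy hzρ h1']
            refine Finset.sum_le_sum fun p _ => Finset.sum_le_sum fun π _ => ?_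
            by_cases hP : IsPrefix v (r / 2 ^ (j + 1)) p.1 p.2 π
            · rw [if_pos hP, if_pos hP]
              exact mul_le_mul_of_nonneg_left (inner_mass_le (v := v) (L := C * r)
                (ρ := r / 2 ^ j) π) (pow_nonneg xc_pos.le _)
            · rw [if_neg hP, if_neg hP]
        _ ≤ η (r / 2 ^ (j + 1)) * (c * (C * r / (r / 2 ^ j)) ^ (-β) * mass D y z v) :=
            mul_le_mul_of_nonneg_left (TR_Ex_EE_le hE hA (hρ1 j ((Nat.le_succ j).trans hj'))
              (hρr j) hrL) (hη _)
        _ = _ := by rw [hLρ]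
  -- (3) the last stratum
  have hB0 : 0 ≤ B₀ := le_trans (by positivity) (crude_constant_le hB)
  have hSNb : ‖TC D s(y, z) v fun l => l ∈ Ex v (C * r) ∧ l ∈ EE v (C * r) (r / 2 ^ N)‖ ≤
      B₀ * (c * (C * 2 ^ N) ^ (-β) * mass D y z v) :=
    calc _ ≤ 1 / 2 * (Real.sqrt 3)⁻¹ *
          TR D s(y, z) v (fun l => l ∈ Ex v (C * r) ∧ l ∈ EE v (C * r) (r / 2 ^ N)) :=
          norm_TC_le _ _ _ _
      _ ≤ B₀ * TR D s(y, z) v (fun l => l ∈ Ex v (C * r) ∧ l ∈ EE v (C * r) (r / 2 ^ N)) :=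
          mul_le_mul_of_nonneg_right (crude_constant_le hB) (TR_nonneg _ _ _ _)
      _ ≤ B₀ * (c * (C * r / (r / 2 ^ N)) ^ (-β) * mass D y z v) :=
          mul_le_mul_of_nonneg_left (TR_Ex_EE_le hE hA (hρ1 N le_rfl) (hρr N) hrL) hB0
      _ = _ := by rw [hLρ]
  -- assembly
  refine ((norm_add_le _ _).trans (add_le_add ((norm_sum_le _ _).trans
    (Finset.sum_le_sum hSj)) hSNb)).trans (le_of_eq ?_)
  rw [strataSum, mul_add, add_mul, Finset.mul_sum, Finset.sum_mul]
  congr 1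
  · exact Finset.sum_congr rfl fun j _ => by ring
  · ring

end Strata

/-! ### Prefix-sum algebra and covariance of picture-domain sums -/

section Assembly

variable {Λ : Finset HexVertex} {u w v : HexVertex} {r : ℝ}

/-- `prefixSumC` is congruent under pointwise equality on prefixes. [folklore] -/
theorem prefixSumC_congr {f g : ∀ y z : HexVertex, HexMidEdgeSAW Λ s(u, w) s(y, z) → ℂ}
    (h : ∀ y z π, IsPrefix v r y z π → f y z π = g y z π) :
    prefixSumC Λ u w v r f = prefixSumC Λ u w v r g :=
  Finset.sum_congr rfl fun p _ => Finset.sum_congr rfl fun π _ => by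
    split_ifs with hP
    · exact h _ _ _ hP
    · rfl

/-- `prefixSumC` is additive. [folklore] -/
theorem prefixSumC_add (f g : ∀ y z : HexVertex, HexMidEdgeSAW Λ s(u, w) s(y, z) → ℂ) :
    prefixSumC Λ u w v r (fun y z π => f y z π + g y z π) =
      prefixSumC Λ u w v r f + prefixSumC Λ u w v r g := by
  simp only [prefixSumC, ← Finset.sum_add_distrib]
  refine Finset.sum_congr rfl fun p _ => Finset.sum_congr rfl fun π _ => ?_
  split_ifs <;> simp

/-- `prefixSumC` commutes with finite sums. [folklore] -/
theorem prefixSumC_sum {ι : Type*} (S : Finset ι)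
    (f : ι → ∀ y z : HexVertex, HexMidEdgeSAW Λ s(u, w) s(y, z) → ℂ) :
    prefixSumC Λ u w v r (fun y z π => ∑ i ∈ S, f i y z π) =
      ∑ i ∈ S, prefixSumC Λ u w v r (f i) := by
  simp only [prefixSumC]
  symm
  rw [Finset.sum_comm]
  refine Finset.sum_congr rfl fun p _ => ?_
  rw [Finset.sum_comm]
  refine Finset.sum_congr rfl fun π _ => ?_
  split_ifs <;> simp

/-- `prefixSumR` is monotone on prefixes. [folklore] -/
theorem prefixSumR_mono {f g : ∀ y z : HexVertex, HexMidEdgeSAW Λ s(u, w) s(y, z) → ℝ}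
    (h : ∀ y z π, IsPrefix v r y z π → f y z π ≤ g y z π) :
    prefixSumR Λ u w v r f ≤ prefixSumR Λ u w v r g :=
  Finset.sum_le_sum fun p _ => Finset.sum_le_sum fun π _ => by
    split_ifs with hP
    · exact h _ _ _ hP
    · exact le_rfl

/-- Constants come out of `prefixSumR`. [folklore] -/
theorem prefixSumR_mul_left (c : ℝ) (f : ∀ y z : HexVertex, HexMidEdgeSAW Λ s(u, w) s(y, z) → ℝ) :
    prefixSumR Λ u w v r (fun y z π => c * f y z π) = c * prefixSumR Λ u w v r f := by
  simp only [prefixSumR, Finset.mul_sum]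
  refine Finset.sum_congr rfl fun p _ => Finset.sum_congr rfl fun π _ => ?_
  split_ifs <;> simp

/-- `‖prefixSumC (w · f)‖ ≤ prefixSumR (x_c^ℓ · g)` when `‖f‖ ≤ g` on prefixes. [folklore] -/
theorem norm_prefixSumC_le (f : ∀ y z : HexVertex, HexMidEdgeSAW Λ s(u, w) s(y, z) → ℂ)
    (g : ∀ y z : HexVertex, HexMidEdgeSAW Λ s(u, w) s(y, z) → ℝ)
    (h : ∀ y z π, IsPrefix v r y z π → ‖f y z π‖ ≤ g y z π) :
    ‖prefixSumC Λ u w v r (fun y z π => π.weight xc (5 / 8) * f y z π)‖ ≤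
      prefixSumR Λ u w v r (fun y z π => xc ^ π.length * g y z π) :=
  norm_prefixSum_le (fun p π => f p.1 p.2 π) (fun p π => g p.1 p.2 π) fun _ _ hP => h _ _ _ hP

end Assembly

/-- **Registered helper `tm_strata_bound`**. [folklore] -/
theorem tm_strata_bound : ∀ (c β B₀ r C L : ℝ) (N : ℕ) (η : ℝ → ℝ) (D : Finset HexVertex)
    (y z v : HexVertex), 0 ≤ c → (∀ ρ, 0 ≤ η ρ) → (∀ ρ, 1 ≤ ρ → DepthBound ρ (η ρ)) → CrudeBound B₀ →
    ExitBound c β → 1 ≤ r / 2 ^ N → 1 ≤ C → Admissible D y z v r →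
    dist (hexCenter z) (hexCenter v) ≤ r → C * r = L →
    ‖TC D s(y, z) v (· ∈ Ex v L)‖ ≤ strataSum c β B₀ r N η C * mass D y z v :=
  fun _ _ _ _ _ _ _ _ _ _ _ _ hc hη hD hB hE hN hC hA hz hL =>
    strata_bound hc hη hD hB hE hN hC hA hz hL

end Summit.CriticalPhenomena.SAWScalingLimit.Theorems.DefectDecoherence.TipMartingale

end
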